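import Mathlib
import Summits.Schanuel.Schanuel.Theses.ToricSector

/-!
# Birth skeleton (BC3) — crux `ToricSchanuel` (item stmt-Schanuel-12030) of route `ToricSector`
# registrar `planner-skel-stmt-Schanuel-12030-0` (mode skeleton-register), 2026-08-17

The crux (the toric SECTOR X₁ of the route, all levels): for every `n` and every `ℚ`-linearly
independent `x ∈ ℂⁿ`, among any `n + 1` `ℤ`-linearly independent Laurent monomials in
`(x₁, …, xₙ, e^{x₁}, …, e^{xₙ})` at least one is transcendental — the point `(x, eˣ) ∈ 𝔾ₘ^{2n}` lies on no
algebraic translate of a subtorus of dimension `≤ n − 1`.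

## The line: the ARITHMETIC-TYPE PARTITION of toric Schanuel, in first-failure form

By Hermite–Lindemann a non-zero complex number `t` has one of three arithmetic types:
`L` (logarithmic: `e^t ∈ ℚ̄`, so `t ∉ ℚ̄`), `A` (algebraic: `t ∈ ℚ̄`, so `e^t ∉ ℚ̄`), `G` (generic: `t, e^t ∉ ℚ̄`).
Sort a configuration `x` by the types of its coordinates: ALL of type `L` (pure-log sector), SOME of
type `A` (tower sector), or neither (generic sector: all `xⱼ` transcendental, some `e^{xⱼ}` transcendental).
Run the levels by strong induction, so that at level `n` toric Schanuel below `n` is in hand — a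
configuration that is bad at level `n` is then automatically MINIMAL (no padding by a coordinate
carrying a private relation), which is what keeps the two first-failure stubs from swallowing each
other or the pure-log stub.  Three registered stubs, self-contained over Mathlib:

* `stub_monomialIndepLogs` — `MonomialIndepLogs` (PURE-LOG SECTOR ≡ MONOMIAL INDEPENDENCE OF
  LOGARITHMS, all ranks; OPEN from `n = 2`): `ℚ`-linearly independent `l₁, …, lₙ` with `e^{lᵢ} ∈ ℚ̄` admit
  no Laurent-monomial relation over `ℚ̄` — `∏ lᵢ^{aᵢ}` is transcendental for every `a ∈ ℤⁿ ∖ 0`.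
  `n = 1` is Hermite–Lindemann; `n = 2` is verbatim the route item `TwoLogMonomialAtom`
  (stmt-Schanuel-12032; `e^{π²}, 2^{log 2}, π·log 2, (log 2)(log 3) ∉ ℚ̄`), whose face `a₁ + a₂ = 0` is
  Gel'fond–Schneider (`LogRatioKnown`); generic `n = 4` contains the four exponentials conjecture
  (`lᵢⱼ = xᵢyⱼ`, `l₁₁l₂₂ = l₁₂l₂₁`).  A consequence of the tree conjecture
  `Literature.Barriers.Schanuel.AlgIndepLogarithms` (a prover may attach that implication with
  `--supports`).  DICTIONARY (proved here, `pureLog_level`): toric Schanuel restricted to `x ∈ 𝓛ⁿ` ⟸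
  `MonomialIndepLogs` — a relation vector with non-zero `x`-part `a` gives the monomial `x^a` times the
  algebraic unit `∏ (e^{xⱼ})^{bⱼ}`; `n + 1` vectors with zero `x`-part live in `ℤⁿ` and cannot be
  independent (rank count).
* `stub_algCoordFirstFailure` — `AlgCoordFirstFailure` (TOWER SECTOR at a first failure; OPEN from
  `n = 2`): if toric Schanuel holds at every level `m < n` (written INLINE, the same first-failure format
  as the route's `FirstFailureIsToric`), no `ℚ`-independent `x ∈ ℂⁿ` with an ALGEBRAIC coordinate is
  toric-bad.  `n = 1` is Hermite–Lindemann (level 1 of the crux, proved in the item's evidence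
  `Level1.lean`); `n = 2` is exactly the route crux `TowerAtom` (stmt-Schanuel-12029; `e^e, eπ, π/e ∉ ℚ̄`):
  with `x = (β, t)`, `β ∈ ℚ̄ˣ`, badness forces `t ≡ qβ`, `Log t ≡ q′β (mod 𝓛)`, i.e. `t = c·e^{q′β}` and
  `c·e^{q′β} − qβ ∈ 𝓛`.  First move for a prover (descent): at a first failure with `xⱼ = β`, the classes of
  `x_{≠j}, Log x_{≠j}` span exactly `n − 1` dimensions modulo `𝓛 = exp⁻¹(ℚ̄)` and `β` lies in that span —
  a GENERALISED TOWER relation `β ≡ Σ_{i≠j} (aᵢ Log xᵢ + bᵢ xᵢ) (mod 𝓛)`, `aᵢ, bᵢ ∈ ℚ`.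
* `stub_genericFirstFailure` — `GenericFirstFailure` (GENERIC SECTOR at a first failure; OPEN from
  `n = 2`): under the same first-failure hypothesis, no `ℚ`-independent `x` with ALL `xⱼ` transcendental
  and SOME `e^{xⱼ}` transcendental is toric-bad.  `n = 1` is elementary (`t^D` algebraic with
  `D = a₀b₁ − a₁b₀ ≠ 0` forces `t ∈ ℚ̄`); `n = 2` is the `r ≠ 0` (self-logarithmic / Lambert / trinomial)
  part of the route crux `SelfLogMonomialAtom` (stmt-Schanuel-12028) with `w` transcendental:
  `x = (β₁w^{m₁}, β₂w^{m₂})`, `e^{xᵢ} ∈ ℚ̄·w^{rᵢ}`, `r ≠ 0`.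

Composition (`toricLevel_of_parts`, sorry-free, kernel-checked; `ToricSchanuel_of` plugs the three
stubs in and concludes the crux BY NAME): strong induction on `n`; the induction hypothesis IS the
first-failure hypothesis of stubs 2–3; case on `∀ i, e^{xᵢ} ∈ ℚ̄` (→ `pureLog_level` from stub 1), else
on `∃ j, xⱼ ∈ ℚ̄` (→ stub 2), else stub 3.  So `ToricSchanuel ⟺ MonomialIndepLogs ∧ AlgCoordFirstFailure
∧ GenericFirstFailure` (each stub is a consequence of the crux by restriction), and at `n = 2` the
three stubs specialise to the route's three level-2 atoms (`TwoLogMonomialAtom`, `TowerAtom`,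
Ω-mixed), i.e. this is the all-level form of the census `ToricCensusTwo` (stmt-Schanuel-12027).

Why this cut and not another: (i) a LEVEL split (`n ≤ 2` / `n ≥ 3`) or a plain SECTOR-COMPLEMENT split
("x ∈ 𝓛ⁿ" / "x ∉ 𝓛ⁿ") is a costume — toric-badness is preserved by PADDING `x` with an independent
coordinate carrying a private relation (an algebraic `β`, or the omega constant `t·e^t = 1`), so the
higher-level / complementary piece re-absorbs the whole crux; the first-failure format kills padding
(a padded configuration has a bad proper sub-configuration).  (ii) The TRANSFER pair
"`MonomialNormalForm` (stmt-Schanuel-12033) + its right-hand side" would put the whole crux in one stub.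
(iii) Neither open stub gives the crux alone: a world with `e^e ∈ ℚ̄` breaks only stub 2 (`n = 2`), a
world with `(log 2)(log 3) ∈ ℚ̄` or `e^{π²} ∈ ℚ̄` breaks only stub 1 (and makes stubs 2–3 VACUOUS above
level 2, their hypothesis failing), a Lambert-type `w` (`w² ∈ 𝓛`, `e^w ∈ ℚ̄·w`) breaks only stub 3.

BC3 probes (planner folder `bc/<Stmt>_probe.lean`, 16 examples per stub, `maxHeartbeats 400000` each,
`lean check` rc 1 with 16/16 failures per file): `Stub → ToricSchanuel` and `Stub → Schanuel` by
`exact?` / `simpa` / `unfold; simpa` / `aesop` / `unfold; aesop` / `first | exact? | simpa | (unfold;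
simpa) | aesop` all FAIL; dedup `example : Stub` by `exact?` / `unfold; simp` / `unfold; aesop` FAILS;
the converse `ToricSchanuel → Stub` (true by restriction) is not found by the battery either.

Disproof used: none relevant — `ledger crux ls stmt-Schanuel-12030` shows no `Disproof.lean` / no
workfiles at registration; `ledger negatives --problem Schanuel` lists only the two PolarPhantoms
statements `trdeg ℚ(y, α) < n` (stmt-Schanuel-6844/6846), which no stub instantiates (every stub
asserts transcendence, never an upper bound).  Item evidence read: Scratch0.lean (level 0 vacuous,
`x = (1, iπ)` ⟹ `eπ ∉ ℚ̄`), Level1.lean (level 1 PROVED from tree Hermite–Lindemann), EE.lean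
(`x = (1, e)` ⟹ `e^e ∉ ℚ̄`) — both hardness witnesses sit in the tower sector (stub 2).
-/

noncomputable section

set_option linter.dupNamespace false

namespace Summit.Schanuel.Schanuel.Cruxes.ToricSchanuel.Birth

open Summit.Schanuel.Schanuel.Theses.ToricSector (ToricSchanuel)

/-! ## Statements (named abbreviations; the registered stubs below restate them verbatim, self-contained) -/

/-- Toric Schanuel at ONE level `n`: the body of `ToricSchanuel` with the level fixed. -/
def ToricLevel (n : ℕ) : Prop :=
  ∀ (x : Fin n → ℂ), LinearIndependent ℚ x → ∀ v : Fin (n + 1) → (Fin n ⊕ Fin n → ℤ),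
    LinearIndependent ℤ v → ∃ k, Transcendental ℚ (∏ i, Sum.elim x (Complex.exp ∘ x) i ^ (v k i))

/-- PURE-LOG SECTOR — MONOMIAL INDEPENDENCE OF LOGARITHMS (all ranks): `ℚ`-linearly independent
logarithms of algebraic numbers `l₁, …, lₙ` (`e^{lᵢ} ∈ ℚ̄`) satisfy no Laurent-monomial relation over `ℚ̄`:
`l^a = ∏ lᵢ^{aᵢ}` is transcendental for every `a ∈ ℤⁿ ∖ 0`. -/
def MonomialIndepLogs : Prop :=
  ∀ (n : ℕ) (l : Fin n → ℂ), LinearIndependent ℚ l → (∀ i, IsAlgebraic ℚ (Complex.exp (l i))) →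
    ∀ a : Fin n → ℤ, a ≠ 0 → Transcendental ℚ (∏ i, l i ^ (a i))

/-- ALGEBRAIC-COORDINATE (TOWER) SECTOR AT A FIRST FAILURE: if toric Schanuel holds at every level
`m < n`, then no `ℚ`-linearly independent `x ∈ ℂⁿ` WITH AN ALGEBRAIC COORDINATE is toric-bad at level `n`. -/
def AlgCoordFirstFailure : Prop :=
  ∀ (n : ℕ), (∀ m < n, ToricLevel m) → ∀ (x : Fin n → ℂ), LinearIndependent ℚ x →
    (∃ j, IsAlgebraic ℚ (x j)) →
    ∀ v : Fin (n + 1) → (Fin n ⊕ Fin n → ℤ), LinearIndependent ℤ v →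
      ∃ k, Transcendental ℚ (∏ i, Sum.elim x (Complex.exp ∘ x) i ^ (v k i))

/-- GENERIC SECTOR AT A FIRST FAILURE: if toric Schanuel holds at every level `m < n`, then no
`ℚ`-linearly independent `x ∈ ℂⁿ` with ALL `xⱼ` transcendental and SOME `e^{xⱼ}` transcendental is
toric-bad at level `n`. -/
def GenericFirstFailure : Prop :=
  ∀ (n : ℕ), (∀ m < n, ToricLevel m) → ∀ (x : Fin n → ℂ), LinearIndependent ℚ x →
    (∀ j, Transcendental ℚ (x j)) → (∃ j, Transcendental ℚ (Complex.exp (x j))) →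
    ∀ v : Fin (n + 1) → (Fin n ⊕ Fin n → ℤ), LinearIndependent ℤ v →
      ∃ k, Transcendental ℚ (∏ i, Sum.elim x (Complex.exp ∘ x) i ^ (v k i))

/-! ## Registered stubs (self-contained signatures over Mathlib only) -/

/-- STUB 1 — `MonomialIndepLogs` (pure-log sector; OPEN from `n = 2`: `n = 1` is Hermite–Lindemann,
`n = 2` is the route item `TwoLogMonomialAtom` (stmt-Schanuel-12032: `e^{π²}, 2^{log 2}, π·log 2 ∉ ℚ̄`),
its face `a₁ + a₂ = 0` is Gel'fond–Schneider (`LogRatioKnown`), generic `n = 4` contains the four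
exponentials conjecture; a consequence of the algebraic independence of logarithms). -/
theorem stub_monomialIndepLogs :
    ∀ (n : ℕ) (l : Fin n → ℂ), LinearIndependent ℚ l → (∀ i, IsAlgebraic ℚ (Complex.exp (l i))) →
      ∀ a : Fin n → ℤ, a ≠ 0 → Transcendental ℚ (∏ i, l i ^ (a i)) := by
  sorry

/-- STUB 2 — `AlgCoordFirstFailure` (tower sector at a first failure; OPEN from `n = 2`: `n = 1` is
Hermite–Lindemann, `n = 2` is exactly the route crux `TowerAtom` (stmt-Schanuel-12029: `e^e, eπ ∉ ℚ̄`)). -/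
theorem stub_algCoordFirstFailure :
    ∀ (n : ℕ), (∀ m < n, ∀ (y : Fin m → ℂ), LinearIndependent ℚ y →
        ∀ u : Fin (m + 1) → (Fin m ⊕ Fin m → ℤ), LinearIndependent ℤ u →
          ∃ k, Transcendental ℚ (∏ i, Sum.elim y (Complex.exp ∘ y) i ^ (u k i))) →
      ∀ (x : Fin n → ℂ), LinearIndependent ℚ x → (∃ j, IsAlgebraic ℚ (x j)) →
      ∀ v : Fin (n + 1) → (Fin n ⊕ Fin n → ℤ), LinearIndependent ℤ v →
        ∃ k, Transcendental ℚ (∏ i, Sum.elim x (Complex.exp ∘ x) i ^ (v k i)) := by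
  sorry

/-- STUB 3 — `GenericFirstFailure` (generic sector at a first failure; OPEN from `n = 2`: `n = 1` is
elementary, `n = 2` is the `r ≠ 0` (self-logarithmic / Lambert) part of the route crux
`SelfLogMonomialAtom` (stmt-Schanuel-12028)). -/
theorem stub_genericFirstFailure :
    ∀ (n : ℕ), (∀ m < n, ∀ (y : Fin m → ℂ), LinearIndependent ℚ y →
        ∀ u : Fin (m + 1) → (Fin m ⊕ Fin m → ℤ), LinearIndependent ℤ u →
          ∃ k, Transcendental ℚ (∏ i, Sum.elim y (Complex.exp ∘ y) i ^ (u k i))) →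
      ∀ (x : Fin n → ℂ), LinearIndependent ℚ x → (∀ j, Transcendental ℚ (x j)) →
      (∃ j, Transcendental ℚ (Complex.exp (x j))) →
      ∀ v : Fin (n + 1) → (Fin n ⊕ Fin n → ℤ), LinearIndependent ℤ v →
        ∃ k, Transcendental ℚ (∏ i, Sum.elim x (Complex.exp ∘ x) i ^ (v k i)) := by
  sorry

/-! ## Sanity (sorry-free): level 0 is vacuous, so the first-failure hypothesis has content from `n = 2` on -/

/-- Level `0` of the crux holds vacuously: `Fin 0 ⊕ Fin 0 → ℤ` is the zero module, so no family
`v : Fin 1 → _` in it is `ℤ`-linearly independent (cf. evidence Scratch0.lean `level_zero_vacuous`). -/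
example : ToricLevel 0 := by
  intro x hx v hv
  exact absurd (Subsingleton.elim (v 0) 0) (hv.ne_zero 0)

/-! ## Composition (sorry-free) -/

/-- The extension-by-zero map `ℤⁿ → ℤ^{n ⊔ n}`, `w ↦ (0, w)` (used to see that `n + 1` relation vectors
supported on the exponential half cannot be `ℤ`-linearly independent). -/
def extendInr (n : ℕ) : (Fin n → ℤ) →ₗ[ℤ] (Fin n ⊕ Fin n → ℤ) where
  toFun w := Sum.elim (0 : Fin n → ℤ) w
  map_add' a b := by
    funext i; cases i <;> simp
  map_smul' c a := by
    funext i; cases i <;> simp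

/-- PURE-LOG CASE of one level, from `MonomialIndepLogs` (the dictionary "toric relation on
`(l, e^l)` with `e^l ∈ ℚ̄ⁿ` ⟹ pure monomial relation `l^a ∈ ℚ̄`"): either some relation vector has a
non-zero `x`-part `a = v k ∘ inl` — then `∏ (e^{xⱼ})^{bⱼ}` is algebraic and non-zero, so the monomial is
transcendental iff `x^a` is, which `MonomialIndepLogs` gives — or all `n + 1` vectors live on the
exponential half `ℤⁿ`, contradicting their `ℤ`-linear independence (rank count). -/
theorem pureLog_level (hM : MonomialIndepLogs) {n : ℕ} (x : Fin n → ℂ) (hx : LinearIndependent ℚ x)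
    (halg : ∀ i, IsAlgebraic ℚ (Complex.exp (x i))) (v : Fin (n + 1) → (Fin n ⊕ Fin n → ℤ))
    (hv : LinearIndependent ℤ v) :
    ∃ k, Transcendental ℚ (∏ i, Sum.elim x (Complex.exp ∘ x) i ^ (v k i)) := by
  classical
  by_cases hA : ∃ k, (fun j => v k (Sum.inl j)) ≠ 0
  · obtain ⟨k, hk⟩ := hA
    refine ⟨k, ?_⟩
    have hT : Transcendental ℚ (∏ j, x j ^ (v k (Sum.inl j))) := hM n x hx halg _ hk
    rw [Fintype.prod_sum_type]
    simp only [Sum.elim_inl, Sum.elim_inr, Function.comp_apply]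
    set A := ∏ j, x j ^ (v k (Sum.inl j)) with hAdef
    set B := ∏ j, Complex.exp (x j) ^ (v k (Sum.inr j)) with hBdef
    have hBmem : B ∈ algebraicClosure ℚ ℂ := by
      refine prod_mem (fun j _ => zpow_mem ?_ _)
      exact mem_algebraicClosure_iff.mpr (halg j)
    have hB0 : B ≠ 0 := by
      rw [hBdef]
      exact Finset.prod_ne_zero_iff.mpr (fun j _ => zpow_ne_zero _ (Complex.exp_ne_zero _))
    unfold Transcendental at hT ⊢
    intro hAB
    apply hT
    have hABmem : A * B ∈ algebraicClosure ℚ ℂ := mem_algebraicClosure_iff.mpr hAB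
    have hAmem : A ∈ algebraicClosure ℚ ℂ := by
      have h := div_mem hABmem hBmem
      rwa [mul_div_cancel_right₀ _ hB0] at h
    exact mem_algebraicClosure_iff.mp hAmem
  · push Not at hA
    exfalso
    -- every relation vector is supported on the exponential half: `v k = (0, w k)`
    set w : Fin (n + 1) → (Fin n → ℤ) := fun k j => v k (Sum.inr j) with hwdef
    have hvw : v = (extendInr n) ∘ w := by
      funext k
      funext i
      cases i with
      | inl j =>
        have h := congrFun (hA k) j
        simpa [extendInr] using h
      | inr j => simp [extendInr, hwdef]
    have hw : LinearIndependent ℤ w := by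
      rw [hvw] at hv
      exact hv.of_comp _
    have hcard := hw.fintype_card_le_finrank
    simp at hcard

/-- THE COMPOSITION with the three parts as hypotheses, concluding `∀ n, ToricLevel n` (the body of the
crux): strong induction on the level `n`; at level `n` with toric Schanuel below `n` in hand (the
induction hypothesis IS the first-failure hypothesis of the two sector stubs), sort the configuration
`x` by the arithmetic type of its coordinates — all `e^{xᵢ}` algebraic (pure-log: `MonomialIndepLogs` via
`pureLog_level`), some `xⱼ` algebraic (tower sector: `AlgCoordFirstFailure`), otherwise all `xⱼ`
transcendental and some `e^{xⱼ}` transcendental (generic sector: `GenericFirstFailure`). -/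
theorem toricLevel_of_parts (hM : MonomialIndepLogs) (hA : AlgCoordFirstFailure)
    (hG : GenericFirstFailure) : ∀ n, ToricLevel n := by
  intro n
  induction n using Nat.strong_induction_on with
  | _ n ih =>
    intro x hx v hv
    by_cases hpure : ∀ i, IsAlgebraic ℚ (Complex.exp (x i))
    · exact pureLog_level hM x hx hpure v hv
    · push Not at hpure
      obtain ⟨i, hi⟩ := hpure
      by_cases halg : ∃ j, IsAlgebraic ℚ (x j)
      · exact hA n ih x hx halg v hv
      · push Not at halg
        exact hG n ih x hx (fun j => halg j) ⟨i, hi⟩ v hv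

/-- **The skeleton concludes the crux BY NAME**: `ToricSchanuel` (route `ToricSector`,
stmt-Schanuel-12030) from the three registered stubs; the only `sorry`s of this file are inside
`stub_monomialIndepLogs`, `stub_algCoordFirstFailure`, `stub_genericFirstFailure`. -/
theorem ToricSchanuel_of : ToricSchanuel :=
  toricLevel_of_parts stub_monomialIndepLogs stub_algCoordFirstFailure stub_genericFirstFailure

end Summit.Schanuel.Schanuel.Cruxes.ToricSchanuel.Birth

end
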